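import Summits.CriticalPhenomena.PercolationContinuityZ3.Theorems.Transplant.FKConnectivityAllQSPDual
import HarnessLib

/-!
# Connectivity correlation inequalities for `φ_{w,q}` — file 71c: the DUAL HOST — the antipodal level of `x ∥ 𝓔` over a cell equals,
# up to a constant, the antipodal level of the subdivided dual host over the dual cell along the complement map

Support file (`--supports stmt-CriticalPhenomena-4575`), FK sub-lane `prim-bschramm-fk-2` (gen 31) of the post-continuity
programme; builds on p205010 (kernel theorem, internal audit signed; external expert review pending).  No definitions, no named
facts, no sorries; standard axioms.  Memo FROM-fk-2-g31-DUALITY.md §3.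

Host `H = x ∥ 𝓔` (`IsTTSP E a b`, root `x = s(a,b) ∉ E`), cell: FREE set `F` with `x ∈ F ⊆ insert x E`, CONTRACTED set `C ⊆ E` disjoint from
`F` (the rest of `E` deleted); the antipodal level of `γ ⊆ F` is `apExpC F C γ = k(γ ∪ C) + k((F \\ γ) ∪ C)` (file 22).  With the face maps
`φ, ψ` of file 71b for the labels `U = ∅`, `D = {x}` put `x'' := s(inl ∅, inl {x})` (the dual root, joining the two outer faces),
upper halves `↑e := s(inl (φ e), inr e)`, the DUAL CELL `F'' := insert x'' ((F.erase x).image ↑)`, `C'' := (E \\ (F ∪ C)).image ↑ ∪ E.image (lower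
halves)` (deleted ↔ contracted; lower halves always contracted) and the COMPLEMENT MAP `γ ↦ γ'' := (if x ∈ γ then ∅ else {x''}) ∪ ((F.erase x) \\ γ).image ↑`.
* `FK.IsTTSP.exists_dualHost` — the dual host is a legal host and cell (`IsTTSP E'' (inl ∅) (inl {x})`, `x'' ∉ E''`, `F'' ⊆ insert x'' E''`,
  `C'' ⊆ E''`, `Disjoint F'' C''`, `γ'' ⊆ F''`, `|F''| = |F|`), the pull-back identities
  `{e ∈ F | ê ∉ γ'' ∪ C''} = γ`, `{e ∈ F | ê ∉ (F'' \ γ'') ∪ C''} = F \ γ` (`ê = x''` for `e = x`, `= ↑e` otherwise — test functions pull back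
  along the complement map with the two replicas exchanged consistently, and `γ ↦ γ''` is injective), the orientation clause of 71b, the LEVEL IDENTITY
  `apExpC F'' C'' γ'' = apExpC F C γ + c` for all `γ ⊆ F`, and its threshold form: for every `J` there is `J''` with
  `apExpC F C γ ≤ J ↔ apExpC F'' C'' γ'' ≤ J''` for all `γ ⊆ F` (`FK.exists_threshold_of_shift`, `FK.one_le_clusterCount_of_nonempty`).
This is the finite, cell-by-cell form of the self-duality of the `q`-free antipodal sums of a planar graph (`k(ω*) = k(ω) + |ω| − |V| + 1`,
Grimmett 2006 (6.3)); the `T2⁺` pipeline applies it to hosts whose special set first separates at a series node (memo §1, §4).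
[cite: Grimmett2006, §6.1 eq. (6.3) (p. 133); §1.4 eq. (1.20) (p. 15)] [folklore: Duffin 1965, §4]
-/

noncomputable section

namespace Summit.CriticalPhenomena.PercolationContinuityZ3.Theorems

namespace FK

open SimpleGraph Literature.Probability.LatticeModels Literature.Probability.Percolation
open scoped Classical

variable {V : Type*}

/-! ### Set algebra of the complement map -/

/-- Upper halves are injective in the edge. [folklore] -/
theorem upper_injective (φ : Sym2 V → Finset (Sym2 V)) :
    Function.Injective (fun e : Sym2 V => s((Sum.inl (φ e) : Finset (Sym2 V) ⊕ Sym2 V), Sum.inr e)) := by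
  intro e e' h
  rcases Sym2.eq_iff.1 h with ⟨_, h2⟩ | ⟨h1, _⟩
  · exact Sum.inr_injective h2
  · exact absurd h1 Sum.inl_ne_inr

section Cell

variable {E F C γ : Finset (Sym2 V)} {x : Sym2 V}

/-- The replica edge set of `γ` inside `E` when `x ∈ γ`: `γ ∪ C = insert x (γ.erase x ∪ C)`. [folklore] -/
theorem union_eq_insert_erase_union (hx : x ∈ γ) : γ ∪ C = insert x (γ.erase x ∪ C) := by
  rw [← Finset.insert_union, Finset.insert_erase hx]

/-- The complement of the replica edge set `γ.erase x ∪ C` in `E` is `((F.erase x) \ γ) ∪ (E \ (F ∪ C))`. [folklore] -/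
theorem sdiff_erase_union_eq (hxE : x ∉ E) (hF : F ⊆ insert x E) (hFC : Disjoint F C) (hγ : γ ⊆ F) :
    E \ (γ.erase x ∪ C) = (F.erase x \ γ) ∪ (E \ (F ∪ C)) := by
  ext e
  simp only [Finset.mem_sdiff, Finset.mem_union, Finset.mem_erase, not_or, not_and, ne_eq]
  constructor
  · rintro ⟨heE, h1, h2⟩
    by_cases heF : e ∈ F
    · exact Or.inl ⟨⟨fun hex => hxE (hex ▸ heE), heF⟩, fun heγ => h1 (fun hex => hxE (hex ▸ heE)) heγ⟩
    · exact Or.inr ⟨heE, heF, h2⟩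
  · rintro (⟨⟨hex, heF⟩, heγ⟩ | ⟨heE, heF, heC⟩)
    · have heE : e ∈ E := (Finset.mem_insert.1 (hF heF)).resolve_left hex
      exact ⟨heE, fun _ h => heγ h, Finset.disjoint_left.1 hFC heF⟩
    · exact ⟨heE, fun _ h => heF (hγ h), heC⟩

/-- The complement of the other replica: `E \ ((F \ γ).erase x ∪ C) = (γ.erase x) ∪ (E \ (F ∪ C))`. [folklore] -/
theorem sdiff_sdiff_erase_union_eq (hxE : x ∉ E) (hF : F ⊆ insert x E) (hFC : Disjoint F C) (hγ : γ ⊆ F) :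
    E \ ((F \ γ).erase x ∪ C) = γ.erase x ∪ (E \ (F ∪ C)) := by
  have h := sdiff_erase_union_eq (γ := F \ γ) hxE hF hFC Finset.sdiff_subset
  rw [h]
  congr 1
  ext e
  simp only [Finset.mem_sdiff, Finset.mem_erase, ne_eq, not_and, not_not]
  exact ⟨fun ⟨⟨hex, heF⟩, h⟩ => ⟨hex, h heF⟩, fun ⟨hex, heγ⟩ => ⟨⟨hex, hγ heγ⟩, fun _ => heγ⟩⟩

end Cell

section Cell2

variable {F γ : Finset (Sym2 V)} {x : Sym2 V}

/-- `(F.erase x) \ ((F.erase x) \ γ) = γ.erase x` for `γ ⊆ F`. [folklore] -/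
theorem erase_sdiff_sdiff_eq (hγ : γ ⊆ F) : F.erase x \ (F.erase x \ γ) = γ.erase x := by
  rw [Finset.sdiff_sdiff_self_left]
  ext e
  simp only [Finset.mem_inter, Finset.mem_erase, ne_eq]
  exact ⟨fun h => ⟨h.1.1, h.2⟩, fun h => ⟨⟨h.1, hγ h.2⟩, h.2⟩⟩

end Cell2

/-- Shifting a family of natural levels by an integer constant: thresholds correspond (`g = f + c`). [folklore] -/
theorem exists_threshold_of_shift {ι : Type*} {P : ι → Prop} {f g : ι → ℕ} {c : ℤ} (h : ∀ i, P i → (g i : ℤ) = f i + c)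
    (hg : ∀ i, P i → 1 ≤ g i) (J : ℕ) : ∃ J' : ℕ, ∀ i, P i → (f i ≤ J ↔ g i ≤ J') := by
  by_cases hJ : 0 ≤ (J : ℤ) + c
  · refine ⟨((J : ℤ) + c).toNat, fun i hi => ?_⟩
    have h1 := h i hi
    constructor
    · intro hf
      have : (g i : ℤ) ≤ ((J : ℤ) + c).toNat := by rw [Int.toNat_of_nonneg hJ]; omega
      exact_mod_cast this
    · intro hg'
      have : (g i : ℤ) ≤ ((J : ℤ) + c).toNat := by exact_mod_cast hg'
      rw [Int.toNat_of_nonneg hJ] at this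
      omega
  · refine ⟨0, fun i hi => ?_⟩
    have h1 := h i hi
    have h2 := hg i hi
    constructor
    · intro hf; exfalso; omega
    · intro hg'; exfalso; omega

/-- A cluster count on a nonempty finite vertex type is positive. [cite: Grimmett2006, §1.2 eq. (1.1) (p. 4)] -/
theorem one_le_clusterCount_of_nonempty {W : Type*} [Fintype W] [Nonempty W] (ω : BondConfig W) : 1 ≤ clusterCount ω ∅ := by
  unfold clusterCount
  haveI : Nonempty (openGraph ω ⊔ wired ∅).ConnectedComponent := ⟨(openGraph ω ⊔ wired ∅).connectedComponentMk (Classical.arbitrary W)⟩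
  exact Nat.card_pos

/-! ### The dual host -/

/-- **The dual host of `x ∥ 𝓔` over a cell.**  For `IsTTSP E a b`, `x = s(a,b) ∉ E`, a free set `F ∋ x` inside `insert x E` and a
contracted set `C ⊆ E` disjoint from `F`: with the face maps of file 71b (labels `∅`, `{x}`), the dual root `x'' = s(inl ∅, inl {x})`, the
dual cell `F'' = insert x'' ((F.erase x).image ↑)`, `C'' = (E \ (F ∪ C)).image ↑ ∪ E.image (lower halves)` and the complement map
`γ'' = (if x ∈ γ then ∅ else {x''}) ∪ ((F.erase x) \ γ).image ↑`: the dual host is a two-terminal series–parallel network plus the root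
`x'' ∉ E''`, `F'' ⊆ insert x'' E''`, `C'' ⊆ E''`, `F''` and `C''` are disjoint, `γ'' ⊆ F''`, the first split of any `S` (`2 ≤ |S ∩ E|`) is
parallel in `E` or in `E''`, and the LEVEL IDENTITY `apExpC F'' C'' γ'' = apExpC F C γ + c` holds for every `γ ⊆ F`.
[cite: Grimmett2006, §6.1 eq. (6.3) (p. 133); §1.4 eq. (1.20) (p. 15)] [folklore: Duffin 1965, §4] -/
theorem IsTTSP.exists_dualHost [Fintype V] {E : Finset (Sym2 V)} {a b : V} (hE : IsTTSP E a b) (hx : s(a, b) ∉ E)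
    {F C : Finset (Sym2 V)} (hxF : s(a, b) ∈ F) (hF : F ⊆ insert s(a, b) E) (hC : C ⊆ E) (hFC : Disjoint F C) :
    ∃ φ ψ : Sym2 V → Finset (Sym2 V),
      IsTTSP (E.image (fun e => s(Sum.inl (φ e), Sum.inr e)) ∪ E.image (fun e => s(Sum.inr e, Sum.inl (ψ e))))
        (Sum.inl ∅) (Sum.inl {s(a, b)})
      ∧ s((Sum.inl ∅ : Finset (Sym2 V) ⊕ Sym2 V), Sum.inl {s(a, b)}) ∉
          E.image (fun e => s(Sum.inl (φ e), Sum.inr e)) ∪ E.image (fun e => s(Sum.inr e, Sum.inl (ψ e)))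
      ∧ insert s((Sum.inl ∅ : Finset (Sym2 V) ⊕ Sym2 V), Sum.inl {s(a, b)}) ((F.erase s(a, b)).image (fun e => s(Sum.inl (φ e), Sum.inr e)))
          ⊆ insert s((Sum.inl ∅ : Finset (Sym2 V) ⊕ Sym2 V), Sum.inl {s(a, b)})
            (E.image (fun e => s(Sum.inl (φ e), Sum.inr e)) ∪ E.image (fun e => s(Sum.inr e, Sum.inl (ψ e))))
      ∧ (E \ (F ∪ C)).image (fun e => s(Sum.inl (φ e), Sum.inr e)) ∪ E.image (fun e => s(Sum.inr e, Sum.inl (ψ e)))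
          ⊆ E.image (fun e => s(Sum.inl (φ e), Sum.inr e)) ∪ E.image (fun e => s(Sum.inr e, Sum.inl (ψ e)))
      ∧ Disjoint (insert s((Sum.inl ∅ : Finset (Sym2 V) ⊕ Sym2 V), Sum.inl {s(a, b)}) ((F.erase s(a, b)).image (fun e => s(Sum.inl (φ e), Sum.inr e))))
          ((E \ (F ∪ C)).image (fun e => s(Sum.inl (φ e), Sum.inr e)) ∪ E.image (fun e => s(Sum.inr e, Sum.inl (ψ e))))
      ∧ (∀ γ : Finset (Sym2 V), γ ⊆ F → (if s(a, b) ∈ γ then (∅ : Finset (Sym2 (Finset (Sym2 V) ⊕ Sym2 V))) else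
            {s((Sum.inl ∅ : Finset (Sym2 V) ⊕ Sym2 V), Sum.inl {s(a, b)})}) ∪ ((F.erase s(a, b)) \ γ).image (fun e => s(Sum.inl (φ e), Sum.inr e))
          ⊆ insert s((Sum.inl ∅ : Finset (Sym2 V) ⊕ Sym2 V), Sum.inl {s(a, b)}) ((F.erase s(a, b)).image (fun e => s(Sum.inl (φ e), Sum.inr e))))
      ∧ (insert s((Sum.inl ∅ : Finset (Sym2 V) ⊕ Sym2 V), Sum.inl {s(a, b)}) ((F.erase s(a, b)).image (fun e => s(Sum.inl (φ e), Sum.inr e)))).card = F.card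
      ∧ (∀ γ : Finset (Sym2 V), γ ⊆ F → F.filter (fun e => (if e = s(a, b) then s((Sum.inl ∅ : Finset (Sym2 V) ⊕ Sym2 V), Sum.inl {s(a, b)})
            else s(Sum.inl (φ e), Sum.inr e)) ∉ ((if s(a, b) ∈ γ then (∅ : Finset (Sym2 (Finset (Sym2 V) ⊕ Sym2 V))) else
            {s((Sum.inl ∅ : Finset (Sym2 V) ⊕ Sym2 V), Sum.inl {s(a, b)})}) ∪ ((F.erase s(a, b)) \ γ).image (fun e => s(Sum.inl (φ e), Sum.inr e))) ∪
            ((E \ (F ∪ C)).image (fun e => s(Sum.inl (φ e), Sum.inr e)) ∪ E.image (fun e => s(Sum.inr e, Sum.inl (ψ e))))) = γ)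
      ∧ (∀ γ : Finset (Sym2 V), γ ⊆ F → F.filter (fun e => (if e = s(a, b) then s((Sum.inl ∅ : Finset (Sym2 V) ⊕ Sym2 V), Sum.inl {s(a, b)})
            else s(Sum.inl (φ e), Sum.inr e)) ∉ (insert s((Sum.inl ∅ : Finset (Sym2 V) ⊕ Sym2 V), Sum.inl {s(a, b)})
              ((F.erase s(a, b)).image (fun e => s(Sum.inl (φ e), Sum.inr e))) \
            ((if s(a, b) ∈ γ then (∅ : Finset (Sym2 (Finset (Sym2 V) ⊕ Sym2 V))) else
              {s((Sum.inl ∅ : Finset (Sym2 V) ⊕ Sym2 V), Sum.inl {s(a, b)})}) ∪ ((F.erase s(a, b)) \ γ).image (fun e => s(Sum.inl (φ e), Sum.inr e)))) ∪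
            ((E \ (F ∪ C)).image (fun e => s(Sum.inl (φ e), Sum.inr e)) ∪ E.image (fun e => s(Sum.inr e, Sum.inl (ψ e))))) = F \ γ)
      ∧ (∀ S : Finset (Sym2 V), 2 ≤ (S ∩ E).card → IsParSplit E a b S ∨
          IsParSplit (E.image (fun e => s(Sum.inl (φ e), Sum.inr e)) ∪ E.image (fun e => s(Sum.inr e, Sum.inl (ψ e))))
            (Sum.inl ∅) (Sum.inl {s(a, b)}) ((S ∩ E).image (fun e => s(Sum.inl (φ e), Sum.inr e))))
      ∧ (∃ c : ℤ, (∀ γ : Finset (Sym2 V), γ ⊆ F →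
          (apExpC (insert s((Sum.inl ∅ : Finset (Sym2 V) ⊕ Sym2 V), Sum.inl {s(a, b)}) ((F.erase s(a, b)).image (fun e => s(Sum.inl (φ e), Sum.inr e))))
              ((E \ (F ∪ C)).image (fun e => s(Sum.inl (φ e), Sum.inr e)) ∪ E.image (fun e => s(Sum.inr e, Sum.inl (ψ e))))
              ((if s(a, b) ∈ γ then (∅ : Finset (Sym2 (Finset (Sym2 V) ⊕ Sym2 V))) else
                {s((Sum.inl ∅ : Finset (Sym2 V) ⊕ Sym2 V), Sum.inl {s(a, b)})}) ∪ ((F.erase s(a, b)) \ γ).image (fun e => s(Sum.inl (φ e), Sum.inr e))) : ℤ)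
            = apExpC F C γ + c)
        ∧ (∀ J : ℕ, ∃ J'' : ℕ, ∀ γ : Finset (Sym2 V), γ ⊆ F → (apExpC F C γ ≤ J ↔
          apExpC (insert s((Sum.inl ∅ : Finset (Sym2 V) ⊕ Sym2 V), Sum.inl {s(a, b)}) ((F.erase s(a, b)).image (fun e => s(Sum.inl (φ e), Sum.inr e))))
              ((E \ (F ∪ C)).image (fun e => s(Sum.inl (φ e), Sum.inr e)) ∪ E.image (fun e => s(Sum.inr e, Sum.inl (ψ e))))
              ((if s(a, b) ∈ γ then (∅ : Finset (Sym2 (Finset (Sym2 V) ⊕ Sym2 V))) else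
                {s((Sum.inl ∅ : Finset (Sym2 V) ⊕ Sym2 V), Sum.inl {s(a, b)})}) ∪ ((F.erase s(a, b)) \ γ).image (fun e => s(Sum.inl (φ e), Sum.inr e))) ≤ J''))) := by
  have hUD : (∅ : Finset (Sym2 V)) ≠ {s(a, b)} := (Finset.singleton_ne_empty _).symm
  have hU : ¬ ((∅ : Finset (Sym2 V)) ⊆ E ∧ (∅ : Finset (Sym2 V)).Nonempty) := fun h => Finset.not_nonempty_empty h.2
  have hD : ¬ (({s(a, b)} : Finset (Sym2 V)) ⊆ E ∧ ({s(a, b)} : Finset (Sym2 V)).Nonempty) :=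
    fun h => hx (h.1 (Finset.mem_singleton_self _))
  obtain ⟨φ, ψ, T, R, N, ⟨c, K⟩, Q, O⟩ := hE.exists_subdividedDual ∅ {s(a, b)} hUD hU hD
  have hinj := upper_injective φ
  -- the dual root is off every half-edge (half-edges carry a subdivision point)
  have hx'' : ∀ A B : Finset (Sym2 V), s((Sum.inl ∅ : Finset (Sym2 V) ⊕ Sym2 V), Sum.inl {s(a, b)}) ∉
      A.image (fun e => s(Sum.inl (φ e), Sum.inr e)) ∪ B.image (fun e => s(Sum.inr e, Sum.inl (ψ e))) := by
    intro A B h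
    rcases Finset.mem_union.1 h with h' | h'
    · obtain ⟨e, _, he⟩ := Finset.mem_image.1 h'
      have hm : (Sum.inr e : Finset (Sym2 V) ⊕ Sym2 V) ∈ s((Sum.inl ∅ : Finset (Sym2 V) ⊕ Sym2 V), Sum.inl {s(a, b)}) :=
        he ▸ Sym2.mem_mk_right _ _
      rcases Sym2.mem_iff.1 hm with h3 | h3 <;> exact Sum.inr_ne_inl h3
    · obtain ⟨e, _, he⟩ := Finset.mem_image.1 h'
      have hm : (Sum.inr e : Finset (Sym2 V) ⊕ Sym2 V) ∈ s((Sum.inl ∅ : Finset (Sym2 V) ⊕ Sym2 V), Sum.inl {s(a, b)}) :=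
        he ▸ Sym2.mem_mk_left _ _
      rcases Sym2.mem_iff.1 hm with h3 | h3 <;> exact Sum.inr_ne_inl h3
  have hFE : F.erase s(a, b) ⊆ E := fun e he =>
    (Finset.mem_insert.1 (hF (Finset.mem_of_mem_erase he))).resolve_left (Finset.ne_of_mem_erase he)
  -- upper halves of free edges are neither contracted upper halves nor lower halves
  have hdisj : Disjoint ((F.erase s(a, b)).image (fun e => s(Sum.inl (φ e), Sum.inr e)))
      ((E \ (F ∪ C)).image (fun e => s(Sum.inl (φ e), Sum.inr e)) ∪ E.image (fun e => s(Sum.inr e, Sum.inl (ψ e)))) := by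
    rw [Finset.disjoint_left]
    intro y hy hy'
    obtain ⟨e, he, rfl⟩ := Finset.mem_image.1 hy
    rcases Finset.mem_union.1 hy' with h' | h'
    · obtain ⟨e', he', hee⟩ := Finset.mem_image.1 h'
      have : e' = e := hinj hee
      subst this
      exact (Finset.mem_sdiff.1 he').2 (Finset.mem_union_left _ (Finset.mem_of_mem_erase he))
    · obtain ⟨e', he', hee⟩ := Finset.mem_image.1 h'
      rcases Sym2.eq_iff.1 hee with ⟨h1, _⟩ | ⟨h1, h2⟩
      · exact Sum.inr_ne_inl h1
      · have : e' = e := Sum.inr_injective h1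
        subst this
        exact N e' (hFE he) (Sum.inl_injective h2).symm
  -- membership of the dual edges of free edges in the complement configuration and in the contracted set
  have upC : ∀ e ∈ F, e ≠ s(a, b) → s(Sum.inl (φ e), Sum.inr e) ∉ (E \ (F ∪ C)).image (fun e => s(Sum.inl (φ e), Sum.inr e)) ∪
      E.image (fun e => s(Sum.inr e, Sum.inl (ψ e))) :=
    fun e heF hex => Finset.disjoint_left.1 hdisj (Finset.mem_image_of_mem _ (Finset.mem_erase.2 ⟨hex, heF⟩))
  have upγ : ∀ γ : Finset (Sym2 V), ∀ e ∈ F, e ≠ s(a, b) →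
      (s(Sum.inl (φ e), Sum.inr e) ∈ (if s(a, b) ∈ γ then (∅ : Finset (Sym2 (Finset (Sym2 V) ⊕ Sym2 V))) else
        {s((Sum.inl ∅ : Finset (Sym2 V) ⊕ Sym2 V), Sum.inl {s(a, b)})}) ∪ ((F.erase s(a, b)) \ γ).image (fun e => s(Sum.inl (φ e), Sum.inr e)) ↔ e ∉ γ) := by
    intro γ e heF hex
    have notI : s(Sum.inl (φ e), Sum.inr e) ∉ (if s(a, b) ∈ γ then (∅ : Finset (Sym2 (Finset (Sym2 V) ⊕ Sym2 V))) else
        {s((Sum.inl ∅ : Finset (Sym2 V) ⊕ Sym2 V), Sum.inl {s(a, b)})}) := by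
      split_ifs
      · exact Finset.notMem_empty _
      · rw [Finset.mem_singleton]
        intro h
        exact hx'' {e} ∅ (h ▸ Finset.mem_union_left _ (Finset.mem_image_of_mem _ (Finset.mem_singleton_self e)))
    rw [Finset.mem_union, or_iff_right notI, Finset.mem_image]
    constructor
    · rintro ⟨e', he', hee⟩
      rw [← hinj hee]
      exact (Finset.mem_sdiff.1 he').2
    · exact fun h => ⟨e, Finset.mem_sdiff.2 ⟨Finset.mem_erase.2 ⟨hex, heF⟩, h⟩, rfl⟩
  have xγ : ∀ γ : Finset (Sym2 V), (s((Sum.inl ∅ : Finset (Sym2 V) ⊕ Sym2 V), Sum.inl {s(a, b)}) ∈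
      (if s(a, b) ∈ γ then (∅ : Finset (Sym2 (Finset (Sym2 V) ⊕ Sym2 V))) else
        {s((Sum.inl ∅ : Finset (Sym2 V) ⊕ Sym2 V), Sum.inl {s(a, b)})}) ∪ ((F.erase s(a, b)) \ γ).image (fun e => s(Sum.inl (φ e), Sum.inr e)) ↔ s(a, b) ∉ γ) := by
    intro γ
    rw [Finset.mem_union, or_iff_left (fun h => hx'' _ E (Finset.mem_union_left _ h))]
    split_ifs with h
    · exact iff_of_false (Finset.notMem_empty _) (not_not.2 h)
    · exact iff_of_true (Finset.mem_singleton_self _) h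
  refine ⟨φ, ψ, T, hx'' E E, ?_, Finset.union_subset_union (Finset.image_subset_image Finset.sdiff_subset) le_rfl,
    Finset.disjoint_insert_left.2 ⟨hx'' _ _, hdisj⟩, fun γ hγ => ?_, ?_, fun γ hγ => ?_, fun γ hγ => ?_, O, ?_⟩
  · exact Finset.insert_subset_insert _ ((Finset.image_subset_image hFE).trans Finset.subset_union_left)
  · refine Finset.union_subset ?_ ((Finset.image_subset_image Finset.sdiff_subset).trans (Finset.subset_insert _ _))
    split_ifs
    · exact Finset.empty_subset _
    · exact Finset.singleton_subset_iff.2 (Finset.mem_insert_self _ _)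
  · rw [Finset.card_insert_of_notMem (fun h => hx'' _ E (Finset.mem_union_left _ h)), Finset.card_image_of_injective _ hinj,
      Finset.card_erase_add_one hxF]
  · -- pull-back of the first dual replica
    ext e
    rw [Finset.mem_filter, Finset.mem_union]
    by_cases hex : e = s(a, b)
    · subst hex
      rw [if_pos rfl, or_iff_left (hx'' _ _), xγ γ, not_not]
      exact ⟨fun h => h.2, fun h => ⟨hxF, h⟩⟩
    · rw [if_neg hex]
      constructor
      · rintro ⟨heF, h⟩
        rw [or_iff_left (upC e heF hex), upγ γ e heF hex, not_not] at h
        exact h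
      · intro h
        refine ⟨hγ h, ?_⟩
        rw [or_iff_left (upC e (hγ h) hex), upγ γ e (hγ h) hex, not_not]
        exact h
  · -- pull-back of the second dual replica
    ext e
    rw [Finset.mem_filter, Finset.mem_sdiff, Finset.mem_union, Finset.mem_sdiff]
    by_cases hex : e = s(a, b)
    · subst hex
      rw [if_pos rfl, or_iff_left (hx'' _ _), xγ γ, not_not, and_iff_right (Finset.mem_insert_self _ _)]
    · rw [if_neg hex]
      constructor
      · rintro ⟨heF, h⟩
        rw [or_iff_left (upC e heF hex), upγ γ e heF hex, not_not,
          and_iff_right (Finset.mem_insert_of_mem (Finset.mem_image_of_mem _ (Finset.mem_erase.2 ⟨hex, heF⟩)))] at h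
        exact ⟨heF, h⟩
      · rintro ⟨heF, h⟩
        refine ⟨heF, ?_⟩
        rw [or_iff_left (upC e heF hex), upγ γ e heF hex, not_not,
          and_iff_right (Finset.mem_insert_of_mem (Finset.mem_image_of_mem _ (Finset.mem_erase.2 ⟨hex, heF⟩)))]
        exact h
  · -- THE LEVEL IDENTITY
    suffices level : ∀ γ : Finset (Sym2 V), γ ⊆ F →
        (apExpC (insert s((Sum.inl ∅ : Finset (Sym2 V) ⊕ Sym2 V), Sum.inl {s(a, b)}) ((F.erase s(a, b)).image (fun e => s(Sum.inl (φ e), Sum.inr e))))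
            ((E \ (F ∪ C)).image (fun e => s(Sum.inl (φ e), Sum.inr e)) ∪ E.image (fun e => s(Sum.inr e, Sum.inl (ψ e))))
            ((if s(a, b) ∈ γ then (∅ : Finset (Sym2 (Finset (Sym2 V) ⊕ Sym2 V))) else
              {s((Sum.inl ∅ : Finset (Sym2 V) ⊕ Sym2 V), Sum.inl {s(a, b)})}) ∪ ((F.erase s(a, b)) \ γ).image (fun e => s(Sum.inl (φ e), Sum.inr e))) : ℤ)
          = apExpC F C γ + (2 * c + F.card + 2 * C.card) by
      refine ⟨2 * c + F.card + 2 * C.card, level, fun J => exists_threshold_of_shift level (fun γ _ => ?_) J⟩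
      unfold apExpC
      exact le_add_right (one_le_clusterCount_of_nonempty _)
    intro γ hγ
    have hγE : γ.erase s(a, b) ⊆ E := (Finset.erase_subset_erase _ hγ).trans hFE
    have hγ'E : (F \ γ).erase s(a, b) ⊆ E := (Finset.erase_subset_erase _ Finset.sdiff_subset).trans hFE
    have hω₁ : γ.erase s(a, b) ∪ C ⊆ E := Finset.union_subset hγE hC
    have hω₂ : (F \ γ).erase s(a, b) ∪ C ⊆ E := Finset.union_subset hγ'E hC
    -- the two replica complements inside `E`
    have c₁ := sdiff_erase_union_eq (C := C) hx hF hFC hγ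
    have c₂ := sdiff_sdiff_erase_union_eq (C := C) hx hF hFC hγ
    -- the two-terminal identities for both replicas
    have k₁ := K _ hω₁
    have k₂ := K _ hω₂
    have q₁ := Q _ hω₁
    have q₂ := Q _ hω₂
    -- cardinalities
    have hd₁ : Disjoint (γ.erase s(a, b)) C := Finset.disjoint_of_subset_left ((Finset.erase_subset _ _).trans hγ) hFC
    have hd₂ : Disjoint ((F \ γ).erase s(a, b)) C :=
      Finset.disjoint_of_subset_left ((Finset.erase_subset _ _).trans Finset.sdiff_subset) hFC
    rw [Finset.card_union_of_disjoint hd₁] at k₁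
    rw [Finset.card_union_of_disjoint hd₂] at k₂
    have hcardγ := Finset.card_sdiff_add_card_eq_card hγ
    by_cases hxγ : s(a, b) ∈ γ
    · -- `x` in the first replica
      have hxγ' : s(a, b) ∉ F \ γ := fun h => (Finset.mem_sdiff.1 h).2 hxγ
      have e₁ : γ ∪ C = insert s(a, b) (γ.erase s(a, b) ∪ C) := union_eq_insert_erase_union hxγ
      have e₂ : (F \ γ) ∪ C = (F \ γ).erase s(a, b) ∪ C := by rw [Finset.erase_eq_of_notMem hxγ']
      have d₁ : ((if s(a, b) ∈ γ then (∅ : Finset (Sym2 (Finset (Sym2 V) ⊕ Sym2 V))) else {s((Sum.inl ∅ : Finset (Sym2 V) ⊕ Sym2 V),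
          Sum.inl {s(a, b)})}) ∪ ((F.erase s(a, b)) \ γ).image (fun e => s(Sum.inl (φ e), Sum.inr e))) ∪
          ((E \ (F ∪ C)).image (fun e => s(Sum.inl (φ e), Sum.inr e)) ∪ E.image (fun e => s(Sum.inr e, Sum.inl (ψ e)))) =
          (E \ (γ.erase s(a, b) ∪ C)).image (fun e => s(Sum.inl (φ e), Sum.inr e)) ∪ E.image (fun e => s(Sum.inr e, Sum.inl (ψ e))) := by
        rw [if_pos hxγ, Finset.empty_union, c₁, Finset.image_union, Finset.union_assoc]
      have d₂ : insert s((Sum.inl ∅ : Finset (Sym2 V) ⊕ Sym2 V), Sum.inl {s(a, b)}) ((F.erase s(a, b)).image (fun e => s(Sum.inl (φ e), Sum.inr e))) \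
          ((if s(a, b) ∈ γ then (∅ : Finset (Sym2 (Finset (Sym2 V) ⊕ Sym2 V))) else {s((Sum.inl ∅ : Finset (Sym2 V) ⊕ Sym2 V),
            Sum.inl {s(a, b)})}) ∪ ((F.erase s(a, b)) \ γ).image (fun e => s(Sum.inl (φ e), Sum.inr e))) ∪
          ((E \ (F ∪ C)).image (fun e => s(Sum.inl (φ e), Sum.inr e)) ∪ E.image (fun e => s(Sum.inr e, Sum.inl (ψ e)))) =
          insert s((Sum.inl ∅ : Finset (Sym2 V) ⊕ Sym2 V), Sum.inl {s(a, b)})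
            ((E \ ((F \ γ).erase s(a, b) ∪ C)).image (fun e => s(Sum.inl (φ e), Sum.inr e)) ∪ E.image (fun e => s(Sum.inr e, Sum.inl (ψ e)))) := by
        rw [if_pos hxγ, Finset.empty_union, Finset.insert_sdiff_of_notMem _ (fun h => hx'' _ E (Finset.mem_union_left _ h)),
          ← Finset.image_sdiff_of_injOn hinj.injOn Finset.sdiff_subset, erase_sdiff_sdiff_eq hγ, c₂, Finset.image_union,
          Finset.insert_union, Finset.union_assoc]
      have p₁ := clusterCount_union_pair_add (↑(γ.erase s(a, b) ∪ C) : BondConfig V) a b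
      have p₂ := clusterCount_union_pair_add
        (↑((E \ ((F \ γ).erase s(a, b) ∪ C)).image (fun e => s(Sum.inl (φ e), Sum.inr e)) ∪ E.image (fun e => s(Sum.inr e, Sum.inl (ψ e)))) :
          BondConfig (Finset (Sym2 V) ⊕ Sym2 V)) (Sum.inl ∅) (Sum.inl {s(a, b)})
      simp only [q₂] at p₂
      have D₁ := congrArg (fun t : Finset (Sym2 (Finset (Sym2 V) ⊕ Sym2 V)) => (t : Set (Sym2 (Finset (Sym2 V) ⊕ Sym2 V)))) d₁
      have D₂ := congrArg (fun t : Finset (Sym2 (Finset (Sym2 V) ⊕ Sym2 V)) => (t : Set (Sym2 (Finset (Sym2 V) ⊕ Sym2 V)))) d₂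
      rw [Finset.card_erase_of_mem hxγ] at k₁
      rw [Finset.erase_eq_of_notMem hxγ'] at k₂ p₂ D₂
      have hγpos : 0 < γ.card := Finset.card_pos.2 ⟨_, hxγ⟩
      unfold apExpC
      rw [e₁, e₂, Finset.erase_eq_of_notMem hxγ']
      simp only [Finset.coe_union, Finset.coe_insert, Finset.coe_sdiff, Set.union_singleton] at D₁ D₂ p₁ p₂ k₁ k₂ ⊢
      rw [D₁, D₂]
      split_ifs at p₁ p₂ k₁ k₂ <;> push_cast at p₁ p₂ k₁ k₂ ⊢ <;> omega
    · -- `x` in the second replica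
      have hxγ' : s(a, b) ∈ F \ γ := Finset.mem_sdiff.2 ⟨hxF, hxγ⟩
      have hxA : s((Sum.inl ∅ : Finset (Sym2 V) ⊕ Sym2 V), Sum.inl {s(a, b)}) ∉ (F.erase s(a, b)).image (fun e => s(Sum.inl (φ e), Sum.inr e)) :=
        fun h => hx'' _ E (Finset.mem_union_left _ h)
      have e₁ : γ ∪ C = γ.erase s(a, b) ∪ C := by rw [Finset.erase_eq_of_notMem hxγ]
      have e₂ : (F \ γ) ∪ C = insert s(a, b) ((F \ γ).erase s(a, b) ∪ C) := union_eq_insert_erase_union hxγ'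
      have d₁ : ((if s(a, b) ∈ γ then (∅ : Finset (Sym2 (Finset (Sym2 V) ⊕ Sym2 V))) else {s((Sum.inl ∅ : Finset (Sym2 V) ⊕ Sym2 V),
          Sum.inl {s(a, b)})}) ∪ ((F.erase s(a, b)) \ γ).image (fun e => s(Sum.inl (φ e), Sum.inr e))) ∪
          ((E \ (F ∪ C)).image (fun e => s(Sum.inl (φ e), Sum.inr e)) ∪ E.image (fun e => s(Sum.inr e, Sum.inl (ψ e)))) =
          insert s((Sum.inl ∅ : Finset (Sym2 V) ⊕ Sym2 V), Sum.inl {s(a, b)})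
            ((E \ (γ.erase s(a, b) ∪ C)).image (fun e => s(Sum.inl (φ e), Sum.inr e)) ∪ E.image (fun e => s(Sum.inr e, Sum.inl (ψ e)))) := by
        rw [if_neg hxγ, c₁, Finset.image_union, Finset.union_assoc, Finset.union_assoc, ← Finset.insert_eq]
      have hsd : insert s((Sum.inl ∅ : Finset (Sym2 V) ⊕ Sym2 V), Sum.inl {s(a, b)}) ((F.erase s(a, b)).image (fun e => s(Sum.inl (φ e), Sum.inr e))) \
          ({s((Sum.inl ∅ : Finset (Sym2 V) ⊕ Sym2 V), Sum.inl {s(a, b)})} ∪ ((F.erase s(a, b)) \ γ).image (fun e => s(Sum.inl (φ e), Sum.inr e))) =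
          (F.erase s(a, b)).image (fun e => s(Sum.inl (φ e), Sum.inr e)) \ ((F.erase s(a, b)) \ γ).image (fun e => s(Sum.inl (φ e), Sum.inr e)) := by
        ext y
        simp only [Finset.mem_sdiff, Finset.mem_insert, Finset.mem_union, Finset.mem_singleton, not_or]
        constructor
        · rintro ⟨h | h, hne, hB⟩
          · exact absurd h hne
          · exact ⟨h, hB⟩
        · rintro ⟨hA, hB⟩
          exact ⟨Or.inr hA, fun h => hxA (h ▸ hA), hB⟩
      have d₂ : insert s((Sum.inl ∅ : Finset (Sym2 V) ⊕ Sym2 V), Sum.inl {s(a, b)}) ((F.erase s(a, b)).image (fun e => s(Sum.inl (φ e), Sum.inr e))) \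
          ((if s(a, b) ∈ γ then (∅ : Finset (Sym2 (Finset (Sym2 V) ⊕ Sym2 V))) else {s((Sum.inl ∅ : Finset (Sym2 V) ⊕ Sym2 V),
            Sum.inl {s(a, b)})}) ∪ ((F.erase s(a, b)) \ γ).image (fun e => s(Sum.inl (φ e), Sum.inr e))) ∪
          ((E \ (F ∪ C)).image (fun e => s(Sum.inl (φ e), Sum.inr e)) ∪ E.image (fun e => s(Sum.inr e, Sum.inl (ψ e)))) =
          (E \ ((F \ γ).erase s(a, b) ∪ C)).image (fun e => s(Sum.inl (φ e), Sum.inr e)) ∪ E.image (fun e => s(Sum.inr e, Sum.inl (ψ e))) := by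
        rw [if_neg hxγ, hsd, ← Finset.image_sdiff_of_injOn hinj.injOn Finset.sdiff_subset, erase_sdiff_sdiff_eq hγ, c₂, Finset.image_union,
          Finset.union_assoc]
      have p₁ := clusterCount_union_pair_add
        (↑((E \ (γ.erase s(a, b) ∪ C)).image (fun e => s(Sum.inl (φ e), Sum.inr e)) ∪ E.image (fun e => s(Sum.inr e, Sum.inl (ψ e)))) :
          BondConfig (Finset (Sym2 V) ⊕ Sym2 V)) (Sum.inl ∅) (Sum.inl {s(a, b)})
      simp only [q₁] at p₁
      have p₂ := clusterCount_union_pair_add (↑((F \ γ).erase s(a, b) ∪ C) : BondConfig V) a b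
      have D₁ := congrArg (fun t : Finset (Sym2 (Finset (Sym2 V) ⊕ Sym2 V)) => (t : Set (Sym2 (Finset (Sym2 V) ⊕ Sym2 V)))) d₁
      have D₂ := congrArg (fun t : Finset (Sym2 (Finset (Sym2 V) ⊕ Sym2 V)) => (t : Set (Sym2 (Finset (Sym2 V) ⊕ Sym2 V)))) d₂
      rw [Finset.erase_eq_of_notMem hxγ] at k₁ p₁ D₁
      rw [Finset.card_erase_of_mem hxγ'] at k₂
      have hγ'pos : 0 < (F \ γ).card := Finset.card_pos.2 ⟨_, hxγ'⟩
      unfold apExpC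
      rw [e₂]
      simp only [Finset.coe_union, Finset.coe_insert, Finset.coe_sdiff, Set.union_singleton] at D₁ D₂ p₁ p₂ k₁ k₂ ⊢
      rw [D₁, D₂]
      split_ifs at p₁ p₂ k₁ k₂ <;> push_cast at p₁ p₂ k₁ k₂ ⊢ <;> omega

end FK

end Summit.CriticalPhenomena.PercolationContinuityZ3.Theorems

end
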